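import Summits.QuantumFields.YangMills.Theorems.AllWindowsColdBoxBoxHighLineOrbitJacobianDefs

/-!
# T-S5.4J — AMENDED TARGET `OrbitNormaliserJacobianR` (planner ym-idea-2 g18, amendment (A) of builder fcl-p3 g25, 2026-08-29T18:32Z)

The target `OrbitNormaliserJacobian` of `TaskS5Laplace.lean` (tree letters ✓p737741 `…OrbitJacobianDefs`) couples its single constant `C` to the
radius-gap hypothesis `r₀ + 1/(C·H⁴·(1+log β)²) ≤ r` in the WRONG direction: the prover of `∃ C` must take `C` large for the three `C·(…) ≤ 1`
hypotheses and the window, but a large `C` SHRINKS the guaranteed gap `r − r₀`, and with the J4 bulk radius `ρ₄ = (r − r₀)/(2·C₄(1+log H)²)`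
the lower Gaussian mass bound needs `β·ρ₄² ≳ n'`, i.e. `C ≤ 1/(680·C₄²)` — incompatible (fcl-p3's count, confirmed by the planner).
AMENDMENT (A): the gap hypothesis is made constant-free, `r₀ + 1/(H⁴·(1+log β)²) ≤ r`; everything else is byte-identical.  Then
`β·ρ₄² ≥ C·H⁴/(4C₄²)` from the window, which closes for `C ≥ 800·C₄²(1+c)` — the right direction.  The consumer (S5 STEP 2) is unharmed: it
chooses `r = r₀ + 1/(H⁴(1+log β)²) ≤ 1/(C·H)`.  The superseded Prop stays in the tree as documentation; the by-name wrapper targets THIS one.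

HONEST LABEL: a task statement (one Prop); nothing is proved here; T-S5.4J, S5, U5, ⟨stmt-QuantumFields-24004⟩ ⟨24335⟩ ⟨24336⟩ remain OPEN;
the Yang–Mills mass gap is NOT proved by this file.
-/

set_option autoImplicit false

noncomputable section

open Literature.MathematicalPhysics.QuantumFieldTheory.AxialGauge (boxEdges)
open Literature.MathematicalPhysics.QuantumLattice (LGConfig)

namespace Summit.QuantumFields.YangMills.Theorems.AllWindowsColdBoxBoxHighLine

/-- **T-S5.4J TARGET, amended (A)** — `OrbitNormaliserJacobian` with the constant-free radius gap `r₀ + 1/(H⁴(1+log β)²) ≤ r`.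
For `β` in the window `C·H¹²(1+log β)⁸ ≤ β`, a Landau configuration `V` with links `≤ r₀²` (`C·r₀·H² ≤ 1`) and a cutoff radius `r` with
`r₀ + 1/(H⁴(1+log β)²) ≤ r`, `C·r·H ≤ 1`: the orbit integral of the Jacobian-weighted insertion is `Z₀·(1 + O(e^{−cH⁴}))`. -/
def OrbitNormaliserJacobianR : Prop :=
  ∃ C c : ℝ, 0 < C ∧ 0 < c ∧ ∀ H : ℕ, 1 ≤ H → ∀ β r₀ r : ℝ, 2 ≤ β →
    C * (H : ℝ) ^ 12 * (1 + Real.log β) ^ 8 ≤ β →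
    0 ≤ r₀ → C * r₀ * (H : ℝ) ^ 2 ≤ 1 →
    r₀ + 1 / ((H : ℝ) ^ 4 * (1 + Real.log β) ^ 2) ≤ r → C * r * H ≤ 1 →
    ∀ V : LGConfig 4 SU2, InLandauGauge H V → (∀ e ∈ boxEdges 4 (2 * H + 1), linkDefect V e ≤ r₀ ^ 2) →
      |orbitAverage H (jacWeight β H r) V / laplaceZ0 β H - 1| ≤ Real.exp (-(c * (H : ℝ) ^ 4))

example : OrbitNormaliserJacobianR → True := fun _ => trivial

end Summit.QuantumFields.YangMills.Theorems.AllWindowsColdBoxBoxHighLine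

end
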